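import Literature.NumberTheory.Irrationality.RivoalZudilin2020.WellPoisedReflectionProofs
import Literature.NumberTheory.Transcendental.ZudilinLinearForm
import HarnessLib

/-!
# Rivoal–Zudilin 2020, Proposition 1 (i): `S_n` and `Ŝ_n` as linear forms in odd zeta values (proof)

Topic `Literature/NumberTheory/Irrationality/RivoalZudilin2020`; proofs-only companion of
`TwoIrrationalOddZetaValues.lean` (no new definition, no new named fact), completing `PartialFractionsProofs.lean`
and `WellPoisedReflectionProofs.lean`. Source: T. Rivoal, W. Zudilin, *A note on odd zeta values*, Sém. Lothar.
Combin. **81** (2020) B81b = arXiv:1803.03160 [RivoalZudilin2020], §3, Proposition 1 (i) and its proof: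

"`S_n = Σ_{j=1}^{A} Σ_{m=0}^{n} p_{j,m} Σ_{k=1}^{∞} d²/dk² (k+m)^{−j} = Σ_j Σ_m p_{j,m} Σ_k j(j+1)/(k+m)^{j+2}
 = Σ_j (Σ_m p_{j,m}) j(j+1) ζ(j+2) − Σ_j Σ_m Σ_{k=1}^{m} j(j+1)p_{j,m}/k^{j+2}`", then `Σ_m p_{1,m} = 0` (residue at
infinity) and `Σ_m p_{j,m} = 0` for even `j` (the symmetry), "Therefore
`S_n = Σ_{j odd, 5≤j≤A+1} (Σ_m (j−2)(j−1)p_{j−2,m}) ζ(j) − Σ_j Σ_m Σ_{k=1}^{m} j(j+1)p_{j,m}/k^{j+2}`", and the same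
computation at the half-integers with "`ζ̂(s) := Σ_{k≥1} (k−½)^{−s} = (2^s−1)ζ(s)`" (the statement file's PROVED
`zetaHat_eq`) gives (7).  This file PROVES

* `iteratedDeriv_two_rfun` — `R″(t) = Σ_{m,j} j(j+1) p_{j,m} (t+m)^{−j−2}` for real `t > 0` (termwise, from the
  expansion (5) = `rfun_eq_sum_pCoeff`);
* `S_eq_sum`, `Shat_eq_sum` — the displayed triple sums for `S_n` and `Ŝ_n` (summation of `Σ_{k≥1}(k+m)^{−s}` and
  `Σ_{k≥1}(k+m−½)^{−s}`, `s ≥ 3`);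
* **`proposition1_i_holds : proposition1_i`** — (6) and (7) with the typed `qCoeff`, `qZero`, `qZeroHat` (the
  regrouping, the two vanishings from `WellPoisedReflectionProofs.lean`, and the re-indexing `j ↦ j + 2` onto
  `oddRange A`, which uses that `A` is even).

Generic lemmas on `(t+i)^{−s}` and on `Σ_{k≥0}(k+1+i)^{−s} = ζ(s) − H_i^{(s)}` are the tree's
(`Transcendental/ZudilinLinearForm.lean`, imported, not restated).

HONEST FRAMING (cells pub-zeta5 / zeta5-irr): systematic search; no irrationality claim unless certified — an identity
expressing two convergent series as explicit linear forms in `ζ(5), ζ(7), …, ζ(A+1)`; nothing about the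
irrationality of any zeta value; the denominators (Proposition 1 (ii)) and the asymptotics (Proposition 3) remain
named facts of the statement file.
-/

noncomputable section

open Finset Filter Topology
open scoped Nat

namespace Literature.NumberTheory.Irrationality.RivoalZudilin2020

open Literature.NumberTheory.Transcendental (zetaValue)
open Literature.NumberTheory.Transcendental.Zudilin2004 (contDiffAt_inv_pow_real iteratedDeriv_two_inv_pow
  hasSum_inv_pow_shift Hsum)

/-! ### `R″` through the partial fractions -/

/-- **`R″(t)` termwise**: for `A ≥ 15` and real `t > 0`,
`R″(t) = Σ_{m=0}^{n} Σ_{j=1}^{A} p_{j,m} · j(j+1) · (t+m)^{−(j+2)}` ("`d²/dk² (k+m)^{−j} = j(j+1)/(k+m)^{j+2}`").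
[cite: RivoalZudilin2020, §3 proof of Proposition 1 (i) (first display)] -/
theorem iteratedDeriv_two_rfun (A n : ℕ) (hA : 15 ≤ A) {t : ℝ} (ht : 0 < t) :
    iteratedDeriv 2 (rfun A n) t = ∑ m ∈ range (n + 1), ∑ j ∈ Icc 1 A,
      pCoeff A n j m * ((j : ℝ) * (j + 1)) * ((t + m) ^ (j + 2))⁻¹ := by
  have heq : rfun A n =ᶠ[𝓝 t]
      fun y => ∑ m ∈ range (n + 1), ∑ j ∈ Icc 1 A, pCoeff A n j m * ((y + m) ^ j)⁻¹ :=
    Filter.eventuallyEq_of_mem (Ioi_mem_nhds ht) fun y hy =>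
      rfun_eq_sum_pCoeff A n hA fun i _ => by
        have hy' : (0 : ℝ) < y := hy
        positivity
  rw [heq.iteratedDeriv_eq]
  rw [iteratedDeriv_fun_sum fun m _ =>
    ContDiffAt.sum fun j _ => contDiffAt_const.mul (contDiffAt_inv_pow_real m j ht)]
  refine sum_congr rfl fun m _ => ?_
  rw [iteratedDeriv_fun_sum fun j _ => contDiffAt_const.mul (contDiffAt_inv_pow_real m j ht)]
  refine sum_congr rfl fun j _ => ?_
  rw [iteratedDeriv_const_mul _ (contDiffAt_inv_pow_real m j ht), iteratedDeriv_two_inv_pow m j ht]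
  ring

/-! ### The shifted zeta sums -/

/-- `Σ_{k ≥ 0} (k+1+m)^{−s} = ζ(s) − Σ_{k=1}^{m} k^{−s}` for `s ≥ 2` (the tree's `Zudilin2004.hasSum_inv_pow_shift`,
with the finite sum written over `ℝ`). [folklore] -/
private theorem hasSum_shift (m : ℕ) {s : ℕ} (hs : 2 ≤ s) :
    HasSum (fun k : ℕ => (((k : ℝ) + 1 + m) ^ s)⁻¹) (zetaValue s - ∑ k ∈ Icc 1 m, 1 / (k : ℝ) ^ s) := by
  have h := hasSum_inv_pow_shift m hs
  have hH : ((Hsum m s : ℚ) : ℝ) = ∑ k ∈ Icc 1 m, 1 / (k : ℝ) ^ s := by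
    rw [Hsum]
    push_cast
    exact sum_congr rfl fun k _ => by rw [one_div]
  rwa [hH] at h

/-- `Σ_{k ≥ 0} (k+½)^{−s}` is summable for `s ≥ 2`. [folklore] -/
private theorem summable_half {s : ℕ} (hs : 2 ≤ s) :
    Summable fun k : ℕ => 1 / ((k : ℝ) + 1 / 2) ^ s := by
  have hg : Summable fun k : ℕ => 1 / ((k : ℝ) + 1) ^ s := by
    simpa using (summable_nat_add_iff 1).2 (Real.summable_one_div_nat_pow.2 (by omega : 1 < s))
  have h1 : Summable fun k : ℕ => 1 / (((k + 1 : ℕ) : ℝ) + 1 / 2) ^ s := by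
    refine Summable.of_nonneg_of_le (fun k => by positivity) (fun k => ?_) hg
    push_cast
    exact one_div_le_one_div_of_le (by positivity) (pow_le_pow_left₀ (by positivity) (by linarith) s)
  exact (summable_nat_add_iff 1).1 h1

/-- `Σ_{k ≥ 0} (k+½+m)^{−s} = ζ̂(s) − Σ_{k=1}^{m} (k−½)^{−s} = (2^s−1)ζ(s) − Σ_{k=1}^{m} (k−½)^{−s}` for `s ≥ 2`
("`ζ̂(s) := Σ_{k≥1} (k−½)^{−s} = (2^s−1)ζ(s)`", the statement file's `zetaHat_eq`).
[cite: RivoalZudilin2020, §3 proof of Proposition 1 (i) (definition of ζ̂)] -/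
theorem hasSum_shift_half (m : ℕ) {s : ℕ} (hs : 2 ≤ s) :
    HasSum (fun k : ℕ => (((k : ℝ) + 1 / 2 + m) ^ s)⁻¹)
      ((2 ^ s - 1) * zetaValue s - ∑ k ∈ Icc 1 m, 1 / ((k : ℝ) - 1 / 2) ^ s) := by
  set f : ℕ → ℝ := fun k => 1 / ((k : ℝ) + 1 / 2) ^ s with hf
  have hz : HasSum f ((2 ^ s - 1) * zetaValue s) := by
    rw [← zetaHat_eq hs]
    exact (summable_half hs).hasSum
  have hshift : HasSum (fun k => f (k + m)) ((2 ^ s - 1) * zetaValue s - ∑ k ∈ range m, f k) :=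
    (hasSum_nat_add_iff m).2 (by rwa [sub_add_cancel])
  have hH : ∑ k ∈ range m, f k = ∑ k ∈ Icc 1 m, 1 / ((k : ℝ) - 1 / 2) ^ s := by
    rw [show Icc 1 m = Ico 1 (m + 1) by rfl, sum_Ico_eq_sum_range, Nat.add_sub_cancel]
    refine sum_congr rfl fun k _ => ?_
    simp only [hf]
    push_cast
    congr 1
    ring
  rw [hH] at hshift
  convert hshift using 1
  funext k
  simp only [hf]
  push_cast
  rw [one_div]
  ring

/-! ### The triple sums for `S_n` and `Ŝ_n` -/

/-- **`S_n` summed** (`A ≥ 15`): `S_n = Σ_{m=0}^{n} Σ_{j=1}^{A} p_{j,m} j(j+1) (ζ(j+2) − Σ_{k=1}^{m} k^{−(j+2)})`.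
[cite: RivoalZudilin2020, §3 proof of Proposition 1 (i) (first display)] -/
theorem S_eq_sum (A n : ℕ) (hA : 15 ≤ A) :
    S A n = ∑ m ∈ range (n + 1), ∑ j ∈ Icc 1 A, pCoeff A n j m * ((j : ℝ) * (j + 1)) *
      (zetaValue (j + 2) - ∑ k ∈ Icc 1 m, 1 / (k : ℝ) ^ (j + 2)) := by
  have hterm : ∀ k : ℕ, iteratedDeriv 2 (rfun A n) ((k : ℝ) + 1)
      = ∑ m ∈ range (n + 1), ∑ j ∈ Icc 1 A,
          pCoeff A n j m * ((j : ℝ) * (j + 1)) * ((((k : ℝ) + 1 + m) ^ (j + 2)))⁻¹ := fun k =>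
    iteratedDeriv_two_rfun A n hA (by positivity)
  have hHas : HasSum (fun k : ℕ => iteratedDeriv 2 (rfun A n) ((k : ℝ) + 1))
      (∑ m ∈ range (n + 1), ∑ j ∈ Icc 1 A, pCoeff A n j m * ((j : ℝ) * (j + 1)) *
        (zetaValue (j + 2) - ∑ k ∈ Icc 1 m, 1 / (k : ℝ) ^ (j + 2))) := by
    simp_rw [hterm]
    refine hasSum_sum fun m _ => hasSum_sum fun j _ => ?_
    exact (hasSum_shift m (by omega)).mul_left _
  unfold S
  exact hHas.tsum_eq

/-- **`Ŝ_n` summed** (`A ≥ 15`):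
`Ŝ_n = Σ_{m=0}^{n} Σ_{j=1}^{A} p_{j,m} j(j+1) ((2^{j+2}−1)ζ(j+2) − Σ_{k=1}^{m} (k−½)^{−(j+2)})`.
[cite: RivoalZudilin2020, §3 proof of Proposition 1 (i) (display (9))] -/
theorem Shat_eq_sum (A n : ℕ) (hA : 15 ≤ A) :
    Shat A n = ∑ m ∈ range (n + 1), ∑ j ∈ Icc 1 A, pCoeff A n j m * ((j : ℝ) * (j + 1)) *
      ((2 ^ (j + 2) - 1) * zetaValue (j + 2) - ∑ k ∈ Icc 1 m, 1 / ((k : ℝ) - 1 / 2) ^ (j + 2)) := by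
  have hterm : ∀ k : ℕ, iteratedDeriv 2 (rfun A n) ((k : ℝ) + 1 / 2)
      = ∑ m ∈ range (n + 1), ∑ j ∈ Icc 1 A,
          pCoeff A n j m * ((j : ℝ) * (j + 1)) * ((((k : ℝ) + 1 / 2 + m) ^ (j + 2)))⁻¹ := fun k =>
    iteratedDeriv_two_rfun A n hA (by positivity)
  have hHas : HasSum (fun k : ℕ => iteratedDeriv 2 (rfun A n) ((k : ℝ) + 1 / 2))
      (∑ m ∈ range (n + 1), ∑ j ∈ Icc 1 A, pCoeff A n j m * ((j : ℝ) * (j + 1)) *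
        ((2 ^ (j + 2) - 1) * zetaValue (j + 2) - ∑ k ∈ Icc 1 m, 1 / ((k : ℝ) - 1 / 2) ^ (j + 2))) := by
    simp_rw [hterm]
    refine hasSum_sum fun m _ => hasSum_sum fun j _ => ?_
    exact (hasSum_shift_half m (by omega)).mul_left _
  unfold Shat
  exact hHas.tsum_eq

/-! ### Regrouping: the coefficients `q_{j,n}` and the constant terms -/

/-- The regrouping step of the proof, common to (6) and (7): with the vanishing of `Σ_m p_{1,m}` (residue) and of
`Σ_m p_{j,m}` for even `j` (reflection), for `A ≥ 16` and `n` even,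
`Σ_m Σ_{j=1}^{A} p_{j,m} j(j+1) (Z(j+2) − Σ_{k≤m} w_k(j+2))
   = −Σ_j Σ_m Σ_{k≤m} j(j+1) p_{j,m} w_k(j+2) + Σ_{j odd, 5≤j≤A+1} q_{j,n} Z(j)` for any values `Z`, `w`
(`Z = ζ` for (6), `Z = ζ̂` for (7)). [cite: RivoalZudilin2020, §3 proof of Proposition 1 (i) ("Therefore …")] -/
theorem regroup {A n : ℕ} (hA : 16 ≤ A) (hAe : Even A) (hn : Even n) (Z : ℕ → ℝ) (w : ℕ → ℕ → ℝ) :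
    ∑ m ∈ range (n + 1), ∑ j ∈ Icc 1 A, pCoeff A n j m * ((j : ℝ) * (j + 1)) *
        (Z (j + 2) - ∑ k ∈ Icc 1 m, w k (j + 2))
      = -(∑ j ∈ Icc 1 A, ∑ m ∈ range (n + 1), ∑ k ∈ Icc 1 m,
            (j : ℝ) * ((j : ℝ) + 1) * pCoeff A n j m * w k (j + 2))
        + ∑ j ∈ oddRange A, qCoeff A n j * Z j := by
  have hA2 : A % 2 = 0 := Nat.even_iff.1 hAe
  -- split into the `Z`-part and the `w`-part
  have hsplit : ∑ m ∈ range (n + 1), ∑ j ∈ Icc 1 A, pCoeff A n j m * ((j : ℝ) * (j + 1)) *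
        (Z (j + 2) - ∑ k ∈ Icc 1 m, w k (j + 2))
      = ∑ m ∈ range (n + 1), ∑ j ∈ Icc 1 A, pCoeff A n j m * ((j : ℝ) * (j + 1)) * Z (j + 2)
        - ∑ m ∈ range (n + 1), ∑ j ∈ Icc 1 A, ∑ k ∈ Icc 1 m,
            (j : ℝ) * ((j : ℝ) + 1) * pCoeff A n j m * w k (j + 2) := by
    rw [← sum_sub_distrib]
    refine sum_congr rfl fun m _ => ?_
    rw [← sum_sub_distrib]
    refine sum_congr rfl fun j _ => ?_
    rw [mul_sub, mul_sum]
    exact congrArg₂ (· - ·) rfl (sum_congr rfl fun k _ => by ring)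
  rw [hsplit, sum_comm (s := range (n + 1)) (t := Icc 1 A)
    (f := fun m j => ∑ k ∈ Icc 1 m, (j : ℝ) * ((j : ℝ) + 1) * pCoeff A n j m * w k (j + 2)),
    sub_eq_neg_add]
  congr 1
  -- the `Z`-part: `Σ_j (Σ_m p_{j,m}) j(j+1) Z(j+2)`, only odd `j ≥ 3` survive
  rw [sum_comm]
  have hT : ∀ j ∈ Icc 1 A, ∑ m ∈ range (n + 1), pCoeff A n j m * ((j : ℝ) * (j + 1)) * Z (j + 2)
      = (∑ m ∈ range (n + 1), pCoeff A n j m) * (((j : ℝ) * (j + 1)) * Z (j + 2)) := fun j _ => by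
    rw [sum_mul]
    exact sum_congr rfl fun m _ => by ring
  rw [sum_congr rfl hT]
  rw [← sum_filter_of_ne (p := fun j => Odd j ∧ j ≠ 1) (fun j hj hne => ?_)]
  · -- re-index `j ↦ j + 2` onto `oddRange A`
    symm
    refine sum_nbij' (fun j => j - 2) (fun j => j + 2) ?_ ?_ ?_ ?_ ?_
    · intro j hj
      simp only [oddRange, mem_filter, mem_Icc] at hj
      have hj2 := Nat.odd_iff.1 hj.2
      simp only [mem_filter, mem_Icc]
      exact ⟨⟨by omega, by omega⟩, Nat.odd_iff.2 (by omega), by omega⟩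
    · intro j hj
      simp only [mem_filter, mem_Icc] at hj
      have hj2 := Nat.odd_iff.1 hj.2.1
      simp only [oddRange, mem_filter, mem_Icc]
      exact ⟨⟨by omega, by omega⟩, Nat.odd_iff.2 (by omega)⟩
    · intro j hj
      simp only [oddRange, mem_filter, mem_Icc] at hj
      show j - 2 + 2 = j
      omega
    · intro j hj
      show j + 2 - 2 = j
      omega
    · intro j hj
      simp only [oddRange, mem_filter, mem_Icc] at hj
      have hj5 : 5 ≤ j := hj.1.1
      have hcast : (((j - 2 : ℕ) : ℝ)) = (j : ℝ) - 2 := by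
        rw [Nat.cast_sub (by omega)]; norm_num
      rw [qCoeff, show j - 2 + 2 = j by omega, ← mul_sum, hcast]
      ring
  · -- the other `j` contribute nothing: `j = 1` (residue) or `j` even (reflection)
    by_contra hcon
    apply hne
    have hj' := mem_Icc.1 hj
    rcases Nat.even_or_odd j with hev | hodd
    · rw [sum_pCoeff_eq_zero_of_even hAe hn hj'.2 hev, zero_mul]
    · have hj1 : j = 1 := by
        by_contra h1
        exact hcon ⟨hodd, h1⟩
      subst hj1
      rw [sum_pCoeff_one_eq_zero A n (by omega), zero_mul]

/-! ### Proposition 1 (i) -/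

/-- **Rivoal–Zudilin 2020, Proposition 1 (i)** — the named fact `proposition1_i` HOLDS: for `A ≥ 16` and `n` both
even, `S_n = q_{0,n} + Σ_{j odd, 5≤j≤A+1} q_{j,n} ζ(j)` (6) and `Ŝ_n = q̂_{0,n} + Σ_{j odd, 5≤j≤A+1} q_{j,n}(2^j−1)ζ(j)`
(7), with the explicit `q_{j,n} = Σ_m (j−2)(j−1)p_{j−2,m}` (10), `q_{0,n}` (11), `q̂_{0,n}` (8) of the proof.
[cite: RivoalZudilin2020, Proposition 1 (i)] -/
theorem proposition1_i_holds : proposition1_i := by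
  intro A n hA hAe hn
  have hA15 : 15 ≤ A := by omega
  refine ⟨?_, ?_⟩
  · rw [S_eq_sum A n hA15, regroup hA hAe hn (fun s => zetaValue s) (fun k s => 1 / (k : ℝ) ^ s), qZero]
    congr 2
    refine sum_congr rfl fun j _ => sum_congr rfl fun m _ => sum_congr rfl fun k _ => ?_
    ring
  · rw [Shat_eq_sum A n hA15, regroup hA hAe hn (fun s => (2 ^ s - 1) * zetaValue s)
      (fun k s => 1 / ((k : ℝ) - 1 / 2) ^ s), qZeroHat]
    congr 1
    · congr 1
      refine sum_congr rfl fun j _ => sum_congr rfl fun m _ => sum_congr rfl fun k _ => ?_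
      ring
    · exact sum_congr rfl fun j _ => by ring

end Literature.NumberTheory.Irrationality.RivoalZudilin2020
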